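import Summits.Schanuel.Schanuel.Theorems.RootDecomp1HWitnessCore

/-!
# RootDecomp1H — THE TRANSVERSE WITNESS, part 2 of 3 (§4–§6: the witness tuple `W₃ = (a₀, √2·a₀, i·a₀)`, its rigidity with
# budget one, and the consequence that it stands clear of the hull in every `S|𝓚` world)

All three parts (`RootDecomp1HWitnessCore` §1–§3, `RootDecomp1HWitnessRigid` §4–§6, `RootDecomp1HWitness` §7–§10) share the
namespace `Summit.Schanuel.Schanuel.Theorems.RootDecomp1HWitness`; importers use the last part.
See part 1 (`RootDecomp1HWitnessCore`) for the full account of the round. lens-5 cell decomp-schanuel g8; `--supports stmt-Schanuel-30564`.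
-/

set_option linter.dupNamespace false

noncomputable section

namespace Summit.Schanuel.Schanuel.Theorems.RootDecomp1HWitness

open Complex Set
open Literature.NumberTheory.Transcendental (exists_nsmul_mem_span_int mem_adjoin_of_mem_span_int ecl Khovanskii.ePD
  Khovanskii.IsSol Khovanskii.kpt Khovanskii.kjac Khovanskii.polyOver Khovanskii.X_mem_polyOver Khovanskii.mem_ecl_iff
  Khovanskii.ePD_map_of_ringHom)
open Summit.Schanuel.Schanuel.Theses.RootDecomp1H (ProductSchanuel RelTowerSchanuel BridgeTransverse)
open Summit.Schanuel.Schanuel.Theorems.RootDecomp1HTowerCells (trdeg_adjoin_adjoin_eq trdeg_adjoin_union_le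
  trdeg_adjoin_range_le)
open Summit.Schanuel.Schanuel.Theorems.RootDecomp1HCurveHull
open Summit.Schanuel.Schanuel.Theorems.RootDecomp1HClearance (InTowerHull)
open Summit.Schanuel.Schanuel.Theorems.RootDecomp1HBlockClearance (trdeg_pairRange_lt_aleph0)

/-- `i` is algebraic over `ℚ` (private copy, see part 1). -/
private theorem isAlgebraic_I : IsAlgebraic ℚ I := by
  refine IsAlgebraic.of_pow (by norm_num : 0 < 2) ?_
  rw [Complex.I_sq]
  exact isAlgebraic_one.neg

/-- Rational numbers are algebraic over `ℚ` (private copy, see part 1). -/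
private theorem isAlgebraic_ratCast (q : ℚ) : IsAlgebraic ℚ (q : ℂ) := by
  have h := isAlgebraic_algebraMap (R := ℚ) (A := ℂ) q
  rwa [eq_ratCast] at h

/-! ## 4. The witness tuple `W₃ = (a₀, √2·a₀, i·a₀)` -/

/-- **THE TRANSVERSE WITNESS** `W₃ = (a₀, √2 a₀, i a₀)`. -/
def W₃ : Fin 3 → ℂ := ![(a₀ : ℂ), rt2 * a₀, I * a₀]

/-- `W₃ 0 = a₀`. -/
@[simp] theorem W₃_zero : W₃ 0 = a₀ := rfl
/-- `W₃ 1 = √2·a₀`. -/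
@[simp] theorem W₃_one : W₃ 1 = rt2 * a₀ := rfl
/-- `W₃ 2 = i·a₀`. -/
@[simp] theorem W₃_two : W₃ 2 = I * a₀ := rfl

/-- `1, √2, i` are linearly independent over `ℚ`. -/
theorem combo_eq_zero {q₀ q₁ q₂ : ℚ} (h : (q₀ : ℂ) + q₁ * rt2 + q₂ * I = 0) : q₀ = 0 ∧ q₁ = 0 ∧ q₂ = 0 := by
  have him := congrArg Complex.im h
  have hre := congrArg Complex.re h
  simp [rt2] at him hre
  -- `him : q₂ = 0`, `hre : q₀ + q₁ * √2 = 0`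
  have hq1 : q₁ = 0 := by
    by_contra hq1
    have hirr : Irrational ((q₁ : ℝ) * Real.sqrt 2) := irrational_sqrt_two.ratCast_mul hq1
    exact hirr.ne_rat (-q₀) (by push_cast; linarith)
  refine ⟨?_, hq1, him⟩
  have : (q₀ : ℝ) = 0 := by rw [hq1] at hre; simpa using hre
  exact_mod_cast this

/-- Membership in `span_ℚ W₃`: `v ∈ span_ℚ W₃` iff `v = (q₀ + q₁√2 + q₂ i)·a₀` for rationals `qᵢ`. -/
theorem mem_span_W₃_iff {v : ℂ} :
    v ∈ Submodule.span ℚ (range W₃) ↔ ∃ q : Fin 3 → ℚ, v = ((q 0 : ℂ) + q 1 * rt2 + q 2 * I) * a₀ := by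
  rw [Submodule.mem_span_range_iff_exists_fun]
  constructor
  · rintro ⟨q, rfl⟩
    exact ⟨q, by simp only [Fin.sum_univ_three, W₃_zero, W₃_one, W₃_two, Rat.smul_def]; ring⟩
  · rintro ⟨q, rfl⟩
    exact ⟨q, by simp only [Fin.sum_univ_three, W₃_zero, W₃_one, W₃_two, Rat.smul_def]; ring⟩

/-- `W₃` is `ℚ`-free. -/
theorem linearIndependent_W₃ : LinearIndependent ℚ W₃ := by
  rw [Fintype.linearIndependent_iff]
  intro g hg
  have hsum : ((g 0 : ℂ) + g 1 * rt2 + g 2 * I) * a₀ = 0 := by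
    rw [Fin.sum_univ_three] at hg
    simp only [W₃_zero, W₃_one, W₃_two, Rat.smul_def] at hg
    linear_combination hg
  have h := combo_eq_zero ((mul_eq_zero.1 hsum).resolve_right a₀_ne_zero)
  intro i
  fin_cases i
  · exact h.1
  · exact h.2.1
  · exact h.2.2

/-- `W₃` is conjugation-stable: `conj` fixes `a₀`, `√2 a₀` and negates `i a₀`. -/
theorem conj_W₃_mem_span : ∀ j, (starRingEnd ℂ) (W₃ j) ∈ Submodule.span ℚ (Set.range W₃) := by
  intro j
  fin_cases j
  · have h : (starRingEnd ℂ) (W₃ 0) = W₃ 0 := by simp [Complex.conj_ofReal]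
    rw [show ((fun i => i) ⟨0, by norm_num⟩ : Fin 3) = 0 from rfl, h]
    exact Submodule.subset_span ⟨0, rfl⟩
  · have h : (starRingEnd ℂ) (W₃ 1) = W₃ 1 := by simp [rt2, Complex.conj_ofReal]
    rw [show ((fun i => i) ⟨1, by norm_num⟩ : Fin 3) = 1 from rfl, h]
    exact Submodule.subset_span ⟨1, rfl⟩
  · have h : (starRingEnd ℂ) (W₃ 2) = -W₃ 2 := by simp [Complex.conj_ofReal, Complex.conj_I]
    rw [show ((fun i => i) ⟨2, by norm_num⟩ : Fin 3) = 2 from rfl, h]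
    exact Submodule.neg_mem _ (Submodule.subset_span ⟨2, rfl⟩)

/-- `W₃` is self-absorbing for EVERY curve-closed subspace: a non-zero vector of its span is `μ·a₀` with `μ ∈ ℚ(√2, i)ˣ`, and a
curve-closed subspace is closed under algebraic scalars. -/
theorem selfAbsorbing_W₃ {K : Submodule ℚ ℂ} (hK : IsCurveClosed K) : SelfAbsorbing K W₃ := by
  intro v hv hv0 hvK j
  obtain ⟨q, rfl⟩ := mem_span_W₃_iff.1 hv
  set μ : ℂ := (q 0 : ℂ) + q 1 * rt2 + q 2 * I with hμ
  have hμ0 : μ ≠ 0 := fun h => hv0 (by rw [h, zero_mul])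
  have hμalg : IsAlgebraic ℚ μ :=
    ((isAlgebraic_ratCast (q 0)).add ((isAlgebraic_ratCast (q 1)).mul isAlgebraic_rt2)).add
      ((isAlgebraic_ratCast (q 2)).mul isAlgebraic_I)
  have ha : (a₀ : ℂ) ∈ K := by
    have := algebraic_mul_mem hK hvK hμalg.inv
    rwa [← mul_assoc, inv_mul_cancel₀ hμ0, one_mul] at this
  fin_cases j
  · exact ha
  · exact algebraic_mul_mem hK ha isAlgebraic_rt2
  · exact algebraic_mul_mem hK ha isAlgebraic_I

/-! ## 5. Rigidity of `W₃` with budget one -/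

/-- The exponential of an integer combination of `W₃`. -/
theorem exp_combo (p : Fin 3 → ℤ) :
    cexp (((p 0 : ℂ) + p 1 * rt2 + p 2 * I) * a₀) = E ^ (p 0) * D ^ (p 1) * c ^ (p 2) := by
  rw [show ((p 0 : ℂ) + p 1 * rt2 + p 2 * I) * a₀ = (p 0 : ℂ) * a₀ + (p 1 : ℂ) * (rt2 * a₀) + (p 2 : ℂ) * (I * a₀) by ring,
    Complex.exp_add, Complex.exp_add, Complex.exp_int_mul, Complex.exp_int_mul, Complex.exp_int_mul]
  rfl

section closure

variable (K : IntermediateField ℚ ℂ)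

/-- Elements of `K` lie in the algebraic closure of `K` in `ℂ`. -/
theorem mem_closure_of_mem {z : ℂ} (hz : z ∈ K) : z ∈ algebraicClosure K ℂ :=
  (mem_algebraicClosure_iff).2 (isAlgebraic_algebraMap (⟨z, hz⟩ : K))

/-- `ℚ`-algebraic numbers lie in the algebraic closure of `K` in `ℂ`. -/
theorem mem_closure_of_isAlgebraic {z : ℂ} (hz : IsAlgebraic ℚ z) : z ∈ algebraicClosure K ℂ :=
  (mem_algebraicClosure_iff).2 (hz.tower_top (L := K))

/-- If `z^k` (`k > 0`) lies in the algebraic closure of `K` in `ℂ`, so does `z`. -/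
theorem mem_closure_of_pow_mem {z : ℂ} {k : ℕ} (hk : 0 < k) (h : z ^ k ∈ algebraicClosure K ℂ) :
    z ∈ algebraicClosure K ℂ :=
  (mem_algebraicClosure_iff).2 (((mem_algebraicClosure_iff).1 h).of_pow hk)

/-- If `z^k` (`k ≠ 0` an integer) lies in the algebraic closure of `K` in `ℂ`, so does `z`. -/
theorem mem_closure_of_zpow_mem {z : ℂ} {k : ℤ} (hk : k ≠ 0) (h : z ^ k ∈ algebraicClosure K ℂ) :
    z ∈ algebraicClosure K ℂ := by
  obtain ⟨m, rfl | rfl⟩ := Int.eq_nat_or_neg k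
  · rw [zpow_natCast] at h
    exact mem_closure_of_pow_mem K (Nat.pos_of_ne_zero (by exact_mod_cast hk)) h
  · rw [zpow_neg, zpow_natCast] at h
    exact mem_closure_of_pow_mem K (Nat.pos_of_ne_zero (fun hm => hk (by simp [hm]))) (inv_mem_iff.1 h)

end closure

/-- **NO HIDDEN CONSTANTS** on the curve `D = E + 1`: a non-trivial monomial `e^p (e + 1)^q` (`p, q ∈ ℤ`) lying in a field `K`
makes `e` algebraic over `K` (the monomial has positive degree, or a zero or a pole at `e = 0` or at `e = −1`). -/
theorem isAlgebraic_of_monomial_mem (K : IntermediateField ℚ ℂ) {p q : ℤ} (hpq : ¬ (p = 0 ∧ q = 0)) {e w : ℂ}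
    (he : e ≠ 0) (he1 : e + 1 ≠ 0) (hwK : w ∈ K) (hw : e ^ p * (e + 1) ^ q = w) : IsAlgebraic K e := by
  have hwalg : algebraMap K ℂ (⟨w, hwK⟩ : K) = w := rfl
  have hm1 : ((-1 : K) ^ 1) ≠ 0 := by norm_num
  cases p with
  | ofNat k =>
    cases q with
    | ofNat l =>
      -- `e^k (e+1)^l = w` with `k + l ≥ 1`: positive degree
      simp only [Int.ofNat_eq_natCast, zpow_natCast] at hw hpq
      have hkl : k + l ≠ 0 := fun h => hpq ⟨by exact_mod_cast (by omega : k = 0), by exact_mod_cast (by omega : l = 0)⟩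
      refine ⟨Polynomial.X ^ k * (Polynomial.X + Polynomial.C 1) ^ l - Polynomial.C ⟨w, hwK⟩, ?_, ?_⟩
      · intro h
        have hdeg : (Polynomial.X ^ k * (Polynomial.X + Polynomial.C 1) ^ l : Polynomial K).natDegree = k + l := by
          rw [(Polynomial.monic_X_pow k).natDegree_mul ((Polynomial.monic_X_add_C 1).pow l),
            (Polynomial.monic_X_add_C 1).natDegree_pow, Polynomial.natDegree_X_pow, Polynomial.natDegree_X_add_C,
            mul_one]
        have := congrArg Polynomial.natDegree h
        rw [Polynomial.natDegree_sub_C, hdeg, Polynomial.natDegree_zero] at this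
        exact hkl this
      · simp only [map_sub, map_mul, map_pow, map_add, Polynomial.aeval_X, Polynomial.aeval_C, map_one, hwalg, hw,
          sub_self]
    | negSucc l =>
      -- `e^k = w (e+1)^(l+1)`: zero of the right-hand side at `e = -1`
      simp only [Int.ofNat_eq_natCast, zpow_natCast, zpow_negSucc] at hw
      rw [mul_inv_eq_iff_eq_mul₀ (pow_ne_zero _ he1)] at hw
      refine ⟨Polynomial.X ^ k - Polynomial.C ⟨w, hwK⟩ * (Polynomial.X + Polynomial.C 1) ^ (l + 1), ?_, ?_⟩
      · intro h
        have := congrArg (Polynomial.eval (-1 : K)) h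
        simp only [Polynomial.eval_sub, Polynomial.eval_mul, Polynomial.eval_pow, Polynomial.eval_X, Polynomial.eval_C,
          Polynomial.eval_add, Polynomial.eval_zero, neg_add_cancel, zero_pow (Nat.succ_ne_zero l), mul_zero,
          sub_zero] at this
        exact pow_ne_zero k (neg_ne_zero.2 (one_ne_zero' K)) this
      · simp only [map_sub, map_mul, map_pow, map_add, Polynomial.aeval_X, Polynomial.aeval_C, map_one, hwalg, ← hw,
          sub_self]
  | negSucc k =>
    cases q with
    | ofNat l =>
      -- `(e+1)^l = w e^(k+1)`: zero of the right-hand side at `e = 0`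
      simp only [Int.ofNat_eq_natCast, zpow_natCast, zpow_negSucc] at hw
      rw [inv_mul_eq_iff_eq_mul₀ (pow_ne_zero _ he)] at hw
      refine ⟨(Polynomial.X + Polynomial.C 1) ^ l - Polynomial.C ⟨w, hwK⟩ * Polynomial.X ^ (k + 1), ?_, ?_⟩
      · intro h
        have := congrArg (Polynomial.eval (0 : K)) h
        simp only [Polynomial.eval_sub, Polynomial.eval_mul, Polynomial.eval_pow, Polynomial.eval_X, Polynomial.eval_C,
          Polynomial.eval_add, Polynomial.eval_zero, zero_add, one_pow, zero_pow (Nat.succ_ne_zero k), mul_zero,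
          sub_zero] at this
        exact one_ne_zero this
      · simp only [map_sub, map_mul, map_pow, map_add, Polynomial.aeval_X, Polynomial.aeval_C, map_one, hwalg, hw]
        ring
    | negSucc l =>
      -- `w e^(k+1) (e+1)^(l+1) = 1`: zero of the left-hand side at `e = 0`
      simp only [zpow_negSucc] at hw
      have hw' : w * e ^ (k + 1) * (e + 1) ^ (l + 1) = 1 := by
        rw [← hw]; field_simp
      refine ⟨Polynomial.C ⟨w, hwK⟩ * Polynomial.X ^ (k + 1) * (Polynomial.X + Polynomial.C 1) ^ (l + 1) - 1, ?_, ?_⟩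
      · intro h
        have := congrArg (Polynomial.eval (0 : K)) h
        simp only [Polynomial.eval_sub, Polynomial.eval_mul, Polynomial.eval_pow, Polynomial.eval_X, Polynomial.eval_C,
          Polynomial.eval_add, Polynomial.eval_one, Polynomial.eval_zero, zero_add, one_pow, zero_pow (Nat.succ_ne_zero k),
          mul_zero, zero_mul, zero_sub] at this
        exact neg_ne_zero.2 (one_ne_zero' K) this
      · simp only [map_sub, map_mul, map_pow, map_add, Polynomial.aeval_X, Polynomial.aeval_C, map_one, hwalg, hw',
          sub_self]

/-- From `IsAlgebraic` data over `K` along one direction to the whole configuration: if `μ·a₀ ∈ K` with `μ ∈ ℚ(√2, i)ˣ` and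
`E`, `c` are algebraic over `K`, then every entry of `(W₃, e^{W₃})` is algebraic over `K`. -/
theorem algebraic_of_direction (K : IntermediateField ℚ ℂ) {μ : ℂ} (hμ0 : μ ≠ 0) (hμalg : IsAlgebraic ℚ μ)
    (hvK : μ * a₀ ∈ K) (hE : E ∈ algebraicClosure K ℂ) (hc : c ∈ algebraicClosure K ℂ) :
    ∀ w ∈ range W₃ ∪ range (cexp ∘ W₃), IsAlgebraic K w := by
  have hμL : μ ∈ algebraicClosure K ℂ := mem_closure_of_isAlgebraic K hμalg
  have ha : (a₀ : ℂ) ∈ algebraicClosure K ℂ := by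
    have h := mul_mem (inv_mem hμL) (mem_closure_of_mem K hvK)
    rwa [← mul_assoc, inv_mul_cancel₀ hμ0, one_mul] at h
  have hD : D ∈ algebraicClosure K ℂ := by
    rw [D_eq]; exact add_mem hE (one_mem _)
  have hrt2 : rt2 ∈ algebraicClosure K ℂ := mem_closure_of_isAlgebraic K isAlgebraic_rt2
  have hI : I ∈ algebraicClosure K ℂ := mem_closure_of_isAlgebraic K isAlgebraic_I
  rintro w (⟨j, rfl⟩ | ⟨j, rfl⟩) <;> rw [← mem_algebraicClosure_iff] <;> fin_cases j
  · exact ha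
  · exact mul_mem hrt2 ha
  · exact mul_mem hI ha
  · exact hE
  · exact hD
  · exact hc

/-- **`W₃` IS RIGID WITH BUDGET ONE.**  Along `v ∈ span_ℚ W₃ ∖ 0` write `M v = (p₀ + p₁√2 + p₂ i)·a₀` (`M ≥ 1`, `p ∈ ℤ³`), so that
`e^{Mv} = E^{p₀} (E+1)^{p₁} c^{p₂}`.  If `p₂ ≠ 0` add `x = E`: then `c^{p₂} ∈ K(E)` and `c` is algebraic.  If `p₂ = 0` add `x = c`:
then `E^{p₀}(E+1)^{p₁} = e^{Mv} ∈ K` with `(p₀, p₁) ≠ 0`, and `E` is algebraic by `isAlgebraic_of_monomial_mem`. -/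
theorem rigid_W₃ : Rigid W₃ 1 := by
  intro v hv hv0
  obtain ⟨M, hM, hMv⟩ := exists_nsmul_mem_span_int W₃ hv
  obtain ⟨p, hp⟩ := (Submodule.mem_span_range_iff_exists_fun ℤ).1 hMv
  set μ : ℂ := (p 0 : ℂ) + p 1 * rt2 + p 2 * I with hμdef
  have hMv' : (M : ℂ) * v = μ * a₀ := by
    have h := hp
    simp only [Fin.sum_univ_three, W₃_zero, W₃_one, W₃_two, zsmul_eq_mul, Rat.smul_def, Rat.cast_natCast] at h
    linear_combination -h
  have hM0 : (M : ℂ) ≠ 0 := Nat.cast_ne_zero.2 hM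
  have hμ0 : μ ≠ 0 := by
    intro h
    apply hv0
    have : (M : ℂ) * v = 0 := by rw [hMv', h, zero_mul]
    exact (mul_eq_zero.1 this).resolve_left hM0
  have hμalg : IsAlgebraic ℚ μ :=
    ((isAlgebraic_intCast (p 0)).add ((isAlgebraic_intCast (p 1)).mul isAlgebraic_rt2)).add
      ((isAlgebraic_intCast (p 2)).mul isAlgebraic_I)
  have hPi : cexp v ^ M = E ^ (p 0) * D ^ (p 1) * c ^ (p 2) := by
    rw [← Complex.exp_nat_mul, hMv', exp_combo]
  -- memberships valid in every `K ∋ v, e^v`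
  have hvK : ∀ K : IntermediateField ℚ ℂ, v ∈ K → μ * a₀ ∈ K := fun K hvK => by
    rw [← hMv']; exact mul_mem (natCast_mem K M) hvK
  have hPiK : ∀ K : IntermediateField ℚ ℂ, cexp v ∈ K → E ^ (p 0) * D ^ (p 1) * c ^ (p 2) ∈ K := fun K hevK => by
    rw [← hPi]; exact pow_mem hevK M
  by_cases hp2 : p 2 = 0
  · -- budget element `c`; `E` algebraic by the no-hidden-constants lemma
    refine ⟨![c], fun K hvK' hevK hxK => algebraic_of_direction K hμ0 hμalg (hvK K hvK') ?_ (mem_closure_of_mem K ?_)⟩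
    · have hmon : E ^ (p 0) * (E + 1) ^ (p 1) = E ^ (p 0) * D ^ (p 1) * c ^ (p 2) := by
        rw [hp2, zpow_zero, mul_one, D_eq]
      have hp01 : ¬ (p 0 = 0 ∧ p 1 = 0) := by
        rintro ⟨h0, h1⟩
        exact hμ0 (by rw [hμdef, h0, h1, hp2]; simp)
      exact (mem_algebraicClosure_iff).2
        (isAlgebraic_of_monomial_mem K hp01 E_ne_zero E_add_one_ne_zero (hPiK K hevK) hmon)
    · simpa using hxK 0
  · -- budget element `E`; `c` algebraic from `c^{p₂} ∈ K(E)`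
    refine ⟨![E], fun K hvK' hevK hxK => ?_⟩
    have hEK : E ∈ K := by simpa using hxK 0
    have hEL : E ∈ algebraicClosure K ℂ := mem_closure_of_mem K hEK
    have hDL : D ∈ algebraicClosure K ℂ := by rw [D_eq]; exact add_mem hEL (one_mem _)
    refine algebraic_of_direction K hμ0 hμalg (hvK K hvK') hEL (mem_closure_of_zpow_mem K hp2 ?_)
    have h : c ^ (p 2) = (E ^ (p 0) * D ^ (p 1) * c ^ (p 2)) * (E ^ (p 0))⁻¹ * (D ^ (p 1))⁻¹ := by
      field_simp [E_ne_zero, D_ne_zero, zpow_ne_zero]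
    rw [h]
    exact mul_mem (mul_mem (mem_closure_of_mem K (hPiK K hevK)) (inv_mem (zpow_mem hEL _))) (inv_mem (zpow_mem hDL _))

/-! ## 6. Consequences: the witness stands clear of the hull -/

/-- **TRANSVERSALITY OF THE WITNESS.**  Under Schanuel on the hull `𝓚` (equivalently `ProductSchanuel ∧ RelTowerSchanuel`,
`structural_iff_schanuelOn_curveHull`), the span of `W₃` meets the span of every `ℚ`-free tower tuple trivially. -/
theorem W₃_inf_towerSpan_eq_bot (hS : SchanuelOn curveHull) :
    ∀ (N : ℕ) (b : Fin N → ℂ), LinearIndependent ℚ b → TowerTuple b →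
      ∀ v ∈ Submodule.span ℚ (range W₃), v ∈ Submodule.span ℚ (range b) → v = 0 :=
  inf_towerSpan_eq_bot hS (by norm_num) linearIndependent_W₃ rigid_W₃ (selfAbsorbing_W₃ isCurveClosed_curveHull)

/-- `span_ℚ W₃ ∩ 𝓚 = 0` under Schanuel on `𝓚`. -/
theorem W₃_transverse (hS : SchanuelOn curveHull) :
    ∀ v ∈ Submodule.span ℚ (range W₃), v ∈ curveHull → v = 0 := by
  intro v hv hvK
  have hTS : TowerSchanuel := towerSchanuel_iff_schanuelOn_curveHull.mpr hS
  have hv' : v ∈ towerHullSet := by rw [towerHullSet_eq_curveHull hTS]; exact hvK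
  obtain ⟨N, b, hb, htow, hvb⟩ := hv'
  exact W₃_inf_towerSpan_eq_bot hS N b hb htow v hv hvb

/-- `W₃` does NOT lie in the tower hull, under Schanuel on `𝓚`: it satisfies the fourth inline hypothesis of `BridgeTransverse`. -/
theorem not_inTowerHull_W₃ (hS : SchanuelOn curveHull) : ¬ InTowerHull W₃ := by
  rintro ⟨N, b, hb, htow, hmem⟩
  have h := W₃_inf_towerSpan_eq_bot hS N b hb htow (W₃ 0) (Submodule.subset_span ⟨0, rfl⟩) (hmem 0)
  exact a₀_ne_zero (by simpa using h)

/-- The same under the route's structural binders `h₃ ∧ h₄`. -/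
theorem not_inTowerHull_W₃_of_structural (hPS : ProductSchanuel) (hRT : RelTowerSchanuel) : ¬ InTowerHull W₃ :=
  not_inTowerHull_W₃ (schanuelOn_curveHull_of_structural hPS hRT)

/-- The same under Schanuel's conjecture itself. -/
theorem not_inTowerHull_W₃_of_schanuel (h : _root_.Schanuel) : ¬ InTowerHull W₃ :=
  not_inTowerHull_W₃ (schanuelOn_curveHull_of_schanuel h)

/-- Under Schanuel on `𝓚`, the abscissa `a₀` lies OUTSIDE the hull. -/
theorem a₀_not_mem_curveHull (hS : SchanuelOn curveHull) : (a₀ : ℂ) ∉ curveHull := fun h =>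
  a₀_ne_zero (W₃_transverse hS _ (Submodule.subset_span ⟨0, rfl⟩) h)

/-- **THE WALL** (why transversality cannot be certified unconditionally today): `a₀ ∉ 𝓚` forces `trdeg ℚ(a₀, e^{a₀}) = 2`, an
open instance of Schanuel's conjecture in rank one-plus (`a₀` is neither known to be algebraic nor a logarithm of an algebraic number). -/
theorem one_lt_trdeg_of_not_mem (h : (a₀ : ℂ) ∉ curveHull) :
    ¬ Algebra.trdeg ℚ ↥(IntermediateField.adjoin ℚ ({(a₀ : ℂ), cexp (a₀ : ℂ)} : Set ℂ)) ≤ 1 := fun hle =>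
  h (mem_of_depthOne isCurveClosed_curveHull hle)


end Summit.Schanuel.Schanuel.Theorems.RootDecomp1HWitness
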